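import Literature.MathematicalPhysics.QuantumFieldTheory.Balaban1983to89.T4GenFunBounds
import HarnessLib

/-!
# NE7ApexFrozenPeierls — Wilson's lattice gauge theory with a FINITE gauge group: the trace gap, uniform Haar data, and the
# Peierls bound `|⟨g⟩_β| ≤ M·|G|^n·e^{−Δβ}` for observables vanishing on the flat sector (theorems only; any gauge group ∕ any finite gauge group)

HONEST FRAMING (page 1).  Cell `pub-balaban`, rung (B)+1 sub-cell t4, lineage `b2b-balaban-t4-ne7-p1`, generation 31 (CRUX PROVER
NE7 #1, ruling e34b3e0c (2)); skeleton `t4/skeletons/NE7-CRUX-R1.md` v1.7.10.  FIXED FINITE T⁴; continuum `SU(N)` Yang–Mills on T⁴ ⇐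
BetaPertH ∧ nine spine estimates (0∕9 proved); BetaPertH ⇐ (D1) ∧ (D4) ∧ CAP+tail; G-an2-4 gates asym, D1 and NE2∕3∕4; NOT infinite
volume, NOT mass gap, NOT Clay.  The crux NE7 (node U5 = `T4ApexVariance.StringwiseMatching` for Bałaban's scheme) and the apex U0
(`Missing.HasContinuumLimit`) are NOT PRINTED and NOT PROVED, and NOTHING below bears on them: this is [our toy] — an HONEST lattice
gauge theory (Wilson's action, product Haar measure, gauge-invariant observables of `Setup` ∕ `Missing`) in the one regime where an
elementary estimate decides everything, a FINITE gauge group at FROZEN couplings.  Its value: every inhabitant of the two apex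
predicates this owner could find in the tree (gen 31 search of the `HasContinuumLimit` ∕ `StringwiseMatching` conclusions:
`T4VarianceMatching`, `T4PathMeanHybrid`, `NE7Pairwise*`, `NE7LawLevel*`, `CovariantMean*`, …) is CONDITIONAL on a rate hypothesis, and
the only unconditional statement about a concrete lattice gauge theory is compactness (`WilsonLoopLimit`: "nothing about the
dynamics of the lattice theory is used anywhere"); the four modules `NE7ApexFrozenPeierls` ∕ `NE7ApexFrozenScheme` (theorems, any finite group) and `NE7ApexFrozenDefs` ∕ `NE7ApexFrozenWitness` (the `Z2` plaquette instance)
inhabit BOTH predicates OUTRIGHT by a Peierls-type energy–entropy bound under the Gibbs measure — a NON-VACUITY WITNESS of the apex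
SHAPES by a lattice gauge theory and a calibration family for apex-level sockets.  The regime is DEGENERATE (no asymptotic freedom;
the limit theory is the trivial flat sector, every string expectation tends to `1`); NOT `SU(N)`, NOT Bałaban's renormalisation
group, NOT NE7, NOT summit progress.

THE MATHEMATICS OF THIS PART ([folklore]; the crudest energy–entropy estimate for a discrete spin system).  `G` a `GaugeGroup`
(normalised "trace" `reTr ≤ 1`, `reTr 1 = 1`); TRACE GAP `Δ`: `reTr g < 1 ⇒ Δ ≤ 1 − reTr g`; Wilson's action `A(U) = Σ_p (1 − reTr U(∂p))`
on the torus `T^{(0)}` of `P` with `n` positively oriented bonds; `Z = ∫e^{−βA}dU`, `⟨g⟩_β = Z⁻¹∫g e^{−βA}dU` (`Missing.expect`).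
§1 (any `G`) `A(U) = 0 ⇒` every plaquette variable is `1` (`reTr_plaqHol_eq_one_of_action_zero`); `A(U) ≠ 0 ⇒ Δ ≤ A(U)`
   (`gap_le_action_of_ne_zero`), hence `e^{−βA(U)} ≤ e^{−Δβ}` off the flat sector and the POINTWISE bound `|g(U)e^{−βA(U)}| ≤ Me^{−Δβ}` for
   `g` vanishing on `{A = 0}` with `|g| ≤ M` (`abs_mul_boltzmann_le`).
§2 (finite `G`, measurable singletons, any `HaarData`) invariance forces `haar{g} = |G|⁻¹` (`haar_one_eq`), so the trivial configuration
   has product-Haar mass `|G|^{−n}` (`fieldMeasure_one`, `fieldMeasureReal_one`).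
§3 (+ `RegularGaugeGroup`) every function of the configuration is measurable (`measurable_of_finiteGroup`); `Z ≥ |G|^{−n}`
   (`inv_card_pow_le_partitionFn`); **`|⟨g⟩_β| ≤ M·|G|^{n}·e^{−Δβ}`** (`abs_expect_le_of_flat_zero`); for an observable `F` with `|F| ≤ 1`,
   `F = 1` on `{A = 0}`: **`|⟨F⟩_β − 1| ≤ 2|G|^{n}e^{−Δβ}`** (`abs_expect_sub_one_le`) and **`|⟨e^{tF}⟩_β − e^t| ≤ 2e^{|t|}|G|^{n}e^{−Δβ}`**
   (`abs_expect_exp_sub_le`).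
No definition; no socket, binder or hypothesis shape.  Consumers: `NE7ApexFrozenScheme`, `NE7ApexFrozenWitness`.
-/

set_option autoImplicit false

noncomputable section

open MeasureTheory Filter Topology ProbabilityTheory
open scoped BigOperators ENNReal

namespace Summit.QuantumFields.BalabanUV.T4Continuum.NE7ApexFrozenPeierls

open Literature.MathematicalPhysics.QuantumFieldTheory.Balaban1983to89
open Missing (boltzmann partitionFn expect)

/-! ## §1 Wilson's action with a trace gap: action zero ⇒ flat plaquettes; action nonzero ⇒ action ≥ Δ -/

section Gap

variable {G : Type*} [GaugeGroup G] {P : Params} {j : ℕ}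

/-- Each plaquette term `1 − Re tr U(∂p)` of Wilson's action is nonnegative. [folklore] -/
theorem one_sub_reTr_nonneg (g : G) : 0 ≤ 1 - reTr g :=
  sub_nonneg.mpr (GaugeGroup.reTr_le_one g)

/-- The trivial configuration has trivial plaquette holonomies. [folklore] -/
theorem plaqHol_one (p : Plaq P j) : GaugeField.plaqHol (1 : GaugeField P j G) p = 1 := by
  simp [GaugeField.plaqHol, show ∀ b, (1 : GaugeField P j G) b = 1 from fun _ => rfl]

/-- The trivial configuration has Wilson action `0`. [folklore] -/
theorem wilsonAction4_one : wilsonAction4 (1 : GaugeField P j G) = 0 := by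
  simp [wilsonAction4, wilsonAction, plaqHol_one, GaugeGroup.reTr_one]

/-- **Action zero ⇒ every plaquette variable equals `1`** (a sum of nonnegative terms vanishes termwise). [folklore] -/
theorem reTr_plaqHol_eq_one_of_action_zero {U : GaugeField P j G} (h : wilsonAction4 U = 0) (p : Plaq P j) :
    reTr (GaugeField.plaqHol U p) = 1 := by
  simp only [wilsonAction4, wilsonAction, one_mul] at h
  have := (Finset.sum_eq_zero_iff_of_nonneg (fun q _ => one_sub_reTr_nonneg (GaugeField.plaqHol U q))).mp h p
    (Finset.mem_univ p)
  linarith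

/-- **Action nonzero ⇒ action at least the trace gap `Δ`** (`reTr g < 1 ⇒ Δ ≤ 1 − reTr g`): some plaquette term is positive,
hence `≥ Δ`, and the other terms are nonnegative. [folklore] -/
theorem gap_le_action_of_ne_zero {Δ : ℝ} (hgap : ∀ g : G, reTr g < 1 → Δ ≤ 1 - reTr g) {U : GaugeField P j G}
    (h : wilsonAction4 U ≠ 0) : Δ ≤ wilsonAction4 U := by
  have hnn : ∀ q ∈ (Finset.univ : Finset (Plaq P j)), 0 ≤ 1 * (1 - reTr (GaugeField.plaqHol U q)) :=
    fun q _ => by rw [one_mul]; exact one_sub_reTr_nonneg _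
  obtain ⟨p, -, hp⟩ : ∃ p ∈ (Finset.univ : Finset (Plaq P j)), 1 * (1 - reTr (GaugeField.plaqHol U p)) ≠ 0 := by
    by_contra hall
    push Not at hall
    exact h ((Finset.sum_eq_zero_iff_of_nonneg hnn).mpr hall)
  have hlt : reTr (GaugeField.plaqHol U p) < 1 :=
    lt_of_le_of_ne (GaugeGroup.reTr_le_one _) fun heq => hp (by rw [heq]; ring)
  calc Δ ≤ 1 - reTr (GaugeField.plaqHol U p) := hgap _ hlt
    _ = 1 * (1 - reTr (GaugeField.plaqHol U p)) := (one_mul _).symm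
    _ ≤ ∑ q, 1 * (1 - reTr (GaugeField.plaqHol U q)) := Finset.single_le_sum hnn (Finset.mem_univ p)
    _ = wilsonAction4 U := rfl

/-- **The Boltzmann weight off the flat sector**: `A(U) ≠ 0`, `β ≥ 0` ⇒ `e^{−βA(U)} ≤ e^{−Δβ}`. [folklore] -/
theorem boltzmann_le_exp_neg_of_ne_zero {Δ β : ℝ} (hβ : 0 ≤ β) (hgap : ∀ g : G, reTr g < 1 → Δ ≤ 1 - reTr g)
    {P : Params} {U : GaugeField P 0 G} (h : wilsonAction4 U ≠ 0) :
    boltzmann P β U ≤ Real.exp (-(Δ * β)) := by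
  unfold boltzmann
  have := gap_le_action_of_ne_zero hgap h
  exact Real.exp_le_exp.mpr (by nlinarith)

/-- The Boltzmann weight of the trivial configuration is `1`. [folklore] -/
theorem boltzmann_one (β : ℝ) : boltzmann P β (1 : GaugeField P 0 G) = 1 := by
  simp [boltzmann, wilsonAction4_one]

/-- POINTWISE PEIERLS BOUND: an observable `g` vanishing on the flat sector `{A = 0}` and bounded by `M` satisfies
`|g(U)·e^{−βA(U)}| ≤ M·e^{−Δβ}` everywhere (`β ≥ 0`, trace gap `Δ`). [folklore] -/
theorem abs_mul_boltzmann_le {Δ β M : ℝ} (hβ : 0 ≤ β) (hgap : ∀ g : G, reTr g < 1 → Δ ≤ 1 - reTr g) (hM : 0 ≤ M)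
    {P : Params} {g : GaugeField P 0 G → ℝ} (hg0 : ∀ U, wilsonAction4 U = 0 → g U = 0) (hgM : ∀ U, |g U| ≤ M)
    (U : GaugeField P 0 G) : |g U * boltzmann P β U| ≤ M * Real.exp (-(Δ * β)) := by
  by_cases hU : wilsonAction4 U = 0
  · rw [hg0 U hU, zero_mul, abs_zero]; positivity
  · rw [abs_mul, abs_of_pos (Missing.boltzmann_pos P β U)]
    exact mul_le_mul (hgM U) (boltzmann_le_exp_neg_of_ne_zero hβ hgap hU) (Missing.boltzmann_pos P β U).le hM

end Gap

/-! ## §2 A finite gauge group: Haar data are uniform, and the trivial configuration has mass `|G|^{−n}` -/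

section FiniteGroup

variable {G : Type*} [GaugeGroup G] [Fintype G] [MeasurableSpace G] [MeasurableSingletonClass G] [HaarData G]

/-- Left invariance forces all singletons to have the mass of `{1}`. [folklore] -/
theorem haar_singleton_eq (g : G) : HaarData.haar ({g} : Set G) = HaarData.haar ({1} : Set G) := by
  have hmeas : Measurable fun h : G => g * h := measurable_of_finite _
  have h2 : (Measure.map (fun h : G => g * h) HaarData.haar) {g} = HaarData.haar ({g} : Set G) := by
    rw [HaarData.map_mul_left (G := G) g]
  rw [Measure.map_apply hmeas (measurableSet_singleton g)] at h2
  have hpre : (fun h : G => g * h) ⁻¹' ({g} : Set G) = {1} := by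
    ext h
    simp
  rw [hpre] at h2
  exact h2.symm

/-- `|G| · haar{1} = 1` (the singletons partition a probability space). [folklore] -/
theorem card_mul_haar_one : (Fintype.card G : ℝ≥0∞) * HaarData.haar ({1} : Set G) = 1 := by
  haveI := HaarData.isProb (G := G)
  have hsum : ∑ g : G, HaarData.haar ({g} : Set G) = HaarData.haar ((Finset.univ : Finset G) : Set G) :=
    sum_measure_singleton (μ := HaarData.haar) (s := (Finset.univ : Finset G))
  simp_rw [haar_singleton_eq] at hsum
  rw [Finset.sum_const, Finset.card_univ, nsmul_eq_mul, Finset.coe_univ, measure_univ] at hsum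
  exact hsum

/-- **Uniformity**: `haar{1} = |G|⁻¹`. [folklore] -/
theorem haar_one_eq : HaarData.haar ({1} : Set G) = (Fintype.card G : ℝ≥0∞)⁻¹ := by
  have h := card_mul_haar_one (G := G)
  have hc : (Fintype.card G : ℝ≥0∞) ≠ 0 := by exact_mod_cast Fintype.card_ne_zero
  calc HaarData.haar ({1} : Set G)
      = (Fintype.card G : ℝ≥0∞)⁻¹ * ((Fintype.card G : ℝ≥0∞) * HaarData.haar ({1} : Set G)) := by
        rw [← mul_assoc, ENNReal.inv_mul_cancel hc (ENNReal.natCast_ne_top _), one_mul]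
    _ = (Fintype.card G : ℝ≥0∞)⁻¹ := by rw [h, mul_one]

variable (G) in
/-- **The trivial configuration has product-Haar mass `|G|^{−n}`**, `n` = number of positively oriented bonds. [folklore] -/
theorem fieldMeasure_one (P : Params) (j : ℕ) :
    fieldMeasure P j G {1} = ((Fintype.card G : ℝ≥0∞)⁻¹) ^ Fintype.card (PBond P j) := by
  haveI := HaarData.isProb (G := G)
  have key : (Measure.pi fun _ : PBond P j => (HaarData.haar : Measure G))
      (Set.univ.pi fun _ : PBond P j => ({1} : Set G)) = ((Fintype.card G : ℝ≥0∞)⁻¹) ^ Fintype.card (PBond P j) := by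
    rw [Measure.pi_pi]
    simp [haar_one_eq, Finset.prod_const, Finset.card_univ]
  have hset : ({(1 : GaugeField P j G)} : Set (GaugeField P j G)) =
      (Set.univ.pi fun _ : PBond P j => ({1} : Set G) : Set (PBond P j → G)) := by
    ext U
    constructor
    · rintro (rfl : U = 1)
      exact fun b _ => rfl
    · intro h
      exact funext fun b => h b (Set.mem_univ b)
  rw [hset]
  exact key

variable (G) in
/-- The same mass as a real number: `|G|⁻¹ ^ n`. [folklore] -/
theorem fieldMeasureReal_one (P : Params) (j : ℕ) :
    (fieldMeasure P j G).real {1} = ((Fintype.card G : ℝ)⁻¹) ^ Fintype.card (PBond P j) := by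
  rw [measureReal_def, fieldMeasure_one, ENNReal.toReal_pow, ENNReal.toReal_inv, ENNReal.toReal_natCast]

end FiniteGroup

/-! ## §3 Peierls: expectations of observables vanishing on the flat sector are `O(|G|^{n}e^{−Δβ})` -/

section Peierls

variable {G : Type*} [GaugeGroup G] [Fintype G] [MeasurableSpace G] [MeasurableSingletonClass G] [HaarData G]
  [RegularGaugeGroup G]

omit [GaugeGroup G] [MeasurableSpace G] [MeasurableSingletonClass G] [HaarData G] [RegularGaugeGroup G] in
/-- Configurations over a finite group form a finite type (stated as a theorem; used through `haveI`). [folklore] -/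
theorem finite_gaugeField (P : Params) (j : ℕ) : Finite (GaugeField P j G) :=
  inferInstanceAs (Finite (PBond P j → G))

omit [GaugeGroup G] [Fintype G] [HaarData G] [RegularGaugeGroup G] in
/-- … with measurable singletons (finite product of discrete factors; a theorem, used through `haveI`). [folklore] -/
theorem measurableSingletonClass_gaugeField (P : Params) (j : ℕ) : MeasurableSingletonClass (GaugeField P j G) :=
  inferInstanceAs (MeasurableSingletonClass (PBond P j → G))

omit [GaugeGroup G] [HaarData G] [RegularGaugeGroup G] in
/-- Over a finite group EVERY function of the configuration is measurable. [folklore] -/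
theorem measurable_of_finiteGroup {P : Params} {j : ℕ} {α : Type*} [MeasurableSpace α] (f : GaugeField P j G → α) :
    Measurable f := by
  haveI := finite_gaugeField (G := G) P j
  haveI := measurableSingletonClass_gaugeField (G := G) P j
  exact measurable_of_finite f

/-- **`Z ≥ |G|^{−n}`** (`β ≥ 0`): the Boltzmann weight dominates the indicator of the trivial configuration. [folklore] -/
theorem inv_card_pow_le_partitionFn (P : Params) {β : ℝ} (hβ : 0 ≤ β) :
    ((Fintype.card G : ℝ)⁻¹) ^ Fintype.card (PBond P 0) ≤ partitionFn (G := G) P β := by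
  haveI := Missing.isProbabilityMeasure_fieldMeasure (G := G) P 0
  haveI := measurableSingletonClass_gaugeField (G := G) P 0
  have hmeas : MeasurableSet ({1} : Set (GaugeField P 0 G)) := measurableSet_singleton _
  rw [← fieldMeasureReal_one G P 0, ← integral_indicator_one hmeas, partitionFn]
  refine integral_mono ((integrable_const (1 : ℝ)).indicator hmeas)
    (Missing.integrable_boltzmann RegularGaugeGroup.measurable_reTr P hβ) fun U => ?_
  by_cases hU : U ∈ ({1} : Set (GaugeField P 0 G))
  · rw [Set.indicator_of_mem hU, Set.mem_singleton_iff.mp hU, Pi.one_apply, boltzmann_one]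
  · rw [Set.indicator_of_notMem hU]
    exact (Missing.boltzmann_pos P β U).le

omit [Fintype G] [MeasurableSingletonClass G] [RegularGaugeGroup G] in
/-- `∫ g e^{−βA} dU` is `O(e^{−Δβ})` for `g` vanishing on the flat sector, `|g| ≤ M`. [folklore] -/
theorem abs_integral_mul_boltzmann_le {Δ β M : ℝ} (hβ : 0 ≤ β) (hgap : ∀ g : G, reTr g < 1 → Δ ≤ 1 - reTr g)
    (hM : 0 ≤ M) (P : Params) {g : GaugeField P 0 G → ℝ} (hg0 : ∀ U, wilsonAction4 U = 0 → g U = 0)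
    (hgM : ∀ U, |g U| ≤ M) :
    |∫ U, g U * boltzmann P β U ∂fieldMeasure P 0 G| ≤ M * Real.exp (-(Δ * β)) := by
  haveI := Missing.isProbabilityMeasure_fieldMeasure (G := G) P 0
  have h := norm_integral_le_of_norm_le_const (μ := fieldMeasure P 0 G)
    (f := fun U => g U * boltzmann P β U) (C := M * Real.exp (-(Δ * β)))
    (Eventually.of_forall fun U => by
      rw [Real.norm_eq_abs]; exact abs_mul_boltzmann_le hβ hgap hM hg0 hgM U)
  rwa [Real.norm_eq_abs, measureReal_def, measure_univ, ENNReal.toReal_one, mul_one] at h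

/-- **PEIERLS BOUND FOR EXPECTATIONS**: `|⟨g⟩_β| ≤ M·|G|^{n}·e^{−Δβ}` for `g` vanishing on the flat sector with `|g| ≤ M`
(`β ≥ 0`, trace gap `Δ`). [folklore] -/
theorem abs_expect_le_of_flat_zero {Δ β M : ℝ} (hβ : 0 ≤ β) (hgap : ∀ g : G, reTr g < 1 → Δ ≤ 1 - reTr g)
    (hM : 0 ≤ M) (P : Params) {g : GaugeField P 0 G → ℝ} (hg0 : ∀ U, wilsonAction4 U = 0 → g U = 0)
    (hgM : ∀ U, |g U| ≤ M) :
    |expect (G := G) P β g| ≤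
      M * (Fintype.card G : ℝ) ^ Fintype.card (PBond P 0) * Real.exp (-(Δ * β)) := by
  have hZ := Missing.partitionFn_pos' (G := G) P hβ
  have hc : (0 : ℝ) < ((Fintype.card G : ℝ)⁻¹) ^ Fintype.card (PBond P 0) := by
    have : (0 : ℝ) < Fintype.card G := by exact_mod_cast Fintype.card_pos
    positivity
  rw [expect, abs_div, abs_of_pos hZ]
  calc |∫ U, g U * boltzmann P β U ∂fieldMeasure P 0 G| / partitionFn (G := G) P β
      ≤ M * Real.exp (-(Δ * β)) / partitionFn (G := G) P β :=
        div_le_div_of_nonneg_right (abs_integral_mul_boltzmann_le hβ hgap hM P hg0 hgM) hZ.le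
    _ ≤ M * Real.exp (-(Δ * β)) / ((Fintype.card G : ℝ)⁻¹) ^ Fintype.card (PBond P 0) :=
        div_le_div_of_nonneg_left (by positivity) hc (inv_card_pow_le_partitionFn P hβ)
    _ = M * (Fintype.card G : ℝ) ^ Fintype.card (PBond P 0) * Real.exp (-(Δ * β)) := by
        rw [inv_pow, div_inv_eq_mul]; ring

/-- Linearity used once: `⟨f − c⟩_β = ⟨f⟩_β − c` for bounded `f` (`β ≥ 0`; every function on the finite configuration space
is measurable). [folklore] -/
theorem expect_sub_const (P : Params) {β : ℝ} (hβ : 0 ≤ β) {f : GaugeField P 0 G → ℝ} {B : ℝ} (hfB : ∀ U, |f U| ≤ B)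
    (c : ℝ) : expect (G := G) P β (fun U => f U - c) = expect (G := G) P β f - c := by
  haveI := Missing.isProbabilityMeasure_fieldMeasure (G := G) P 0
  have hZ := Missing.partitionFn_pos' (G := G) P hβ
  have hbol := Missing.integrable_boltzmann (G := G) RegularGaugeGroup.measurable_reTr P hβ
  have hf : Integrable (fun U => f U * boltzmann P β U) (fieldMeasure P 0 G) := by
    refine Integrable.of_bound ((measurable_of_finiteGroup _).aestronglyMeasurable) (max B 0 * 1)
      (Eventually.of_forall fun U => ?_)
    rw [Real.norm_eq_abs, abs_mul, abs_of_pos (Missing.boltzmann_pos P β U)]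
    exact mul_le_mul ((hfB U).trans (le_max_left _ _)) (Missing.boltzmann_le_one P hβ U)
      (Missing.boltzmann_pos P β U).le (le_max_right _ _)
  have hsplit : (fun U => (f U - c) * boltzmann P β U) =
      fun U => f U * boltzmann P β U - c * boltzmann P β U := funext fun U => by ring
  rw [expect, expect, hsplit, integral_sub hf (hbol.const_mul c), integral_const_mul, sub_div, ← partitionFn,
    mul_div_cancel_right₀ _ hZ.ne']

/-- **`|⟨F⟩_β − 1| ≤ 2|G|^{n}e^{−Δβ}`** for an observable `F` bounded by `1` and equal to `1` on the flat sector. [folklore] -/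
theorem abs_expect_sub_one_le {Δ β : ℝ} (hβ : 0 ≤ β) (hgap : ∀ g : G, reTr g < 1 → Δ ≤ 1 - reTr g) (P : Params)
    {F : GaugeField P 0 G → ℝ} (hF1 : ∀ U, |F U| ≤ 1) (hflat : ∀ U, wilsonAction4 U = 0 → F U = 1) :
    |expect (G := G) P β F - 1| ≤ 2 * (Fintype.card G : ℝ) ^ Fintype.card (PBond P 0) * Real.exp (-(Δ * β)) := by
  rw [← expect_sub_const P hβ hF1 1]
  refine abs_expect_le_of_flat_zero hβ hgap (by norm_num) P (fun U hU => by rw [hflat U hU, sub_self]) fun U => ?_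
  calc |F U - 1| ≤ |F U| + |(1 : ℝ)| := abs_sub _ _
    _ ≤ 1 + 1 := add_le_add (hF1 U) (by norm_num)
    _ = 2 := by norm_num

/-- **`|⟨e^{tF}⟩_β − e^{t}| ≤ 2e^{|t|}|G|^{n}e^{−Δβ}`** for the same `F` (the exponential moments freeze too). [folklore] -/
theorem abs_expect_exp_sub_le {Δ β : ℝ} (hβ : 0 ≤ β) (hgap : ∀ g : G, reTr g < 1 → Δ ≤ 1 - reTr g) (P : Params)
    {F : GaugeField P 0 G → ℝ} (hF1 : ∀ U, |F U| ≤ 1) (hflat : ∀ U, wilsonAction4 U = 0 → F U = 1) (t : ℝ) :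
    |expect (G := G) P β (fun U => Real.exp (t * F U)) - Real.exp t| ≤
      2 * Real.exp |t| * (Fintype.card G : ℝ) ^ Fintype.card (PBond P 0) * Real.exp (-(Δ * β)) := by
  have hexpB : ∀ U, |Real.exp (t * F U)| ≤ Real.exp |t| := fun U => by
    rw [abs_of_pos (Real.exp_pos _)]
    exact T4GenFunBounds.exp_mul_le_of_abs_le (B := 1) (hF1 U) |>.trans (by rw [mul_one])
  rw [← expect_sub_const P hβ hexpB (Real.exp t)]
  have hM : (0 : ℝ) ≤ 2 * Real.exp |t| := by positivity
  refine abs_expect_le_of_flat_zero hβ hgap hM P (fun U hU => by rw [hflat U hU, mul_one, sub_self]) fun U => ?_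
  have h1 : Real.exp t ≤ Real.exp |t| := Real.exp_le_exp.mpr (le_abs_self t)
  calc |Real.exp (t * F U) - Real.exp t| ≤ |Real.exp (t * F U)| + |Real.exp t| := abs_sub _ _
    _ ≤ Real.exp |t| + Real.exp |t| := add_le_add (hexpB U) (by rwa [abs_of_pos (Real.exp_pos t)])
    _ = 2 * Real.exp |t| := by ring

end Peierls

end Summit.QuantumFields.BalabanUV.T4Continuum.NE7ApexFrozenPeierls

end
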